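import Summits.QuantumFields.BalabanUV.Beta.GAN24.PeriodicDataFaceSums
import Summits.QuantumFields.BalabanUV.Beta.GAN24.DataColumnCombRows
import Summits.QuantumFields.BalabanUV.Beta.GAN24.GaugeLegDefectsBlockConstant
import Summits.QuantumFields.BalabanUV.Beta.GAN24.BorderGaugeLegBlockPotential

/-!
# `BalabanUV.Beta.GAN24.TwoLevelDefectVanishing` — binder row G-an2-4 ∕ (CONV-C), the (S) row ∕ (W-γ) one level up:
# **THE TWO-LEVEL DEFECT (C2′) VANISHES — `Σ'_w Σ_μ dψ(μ,w)·(BO − EI)(H_j n)(μ,w)·(C_j h)(μ,w) = 0` for the two-level datum `h = colH G_{j+1}(e)`, every bounded `Lc`-periodic `n`,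
# every block label `ψ = 1_{B(y)}` (`Lc` odd, centred root, every `j`, every slot `e = (ν, y′)`)**
# (G-an2-4 CRUX TEAM (2), seat `b2b-balaban-gan24-formalise-leaf-06` = the (γ) hand, gen 49, FILE (δ2b))

NOT IN PRINT; OUR BOOKKEEPING ([folklore] BY NAME over TODAY's chain: (T1) `DataColumnCombRows.E2row_colH_eq_contourSumAdj_colM_succ` ((E3): the value-Hessian image of a two-level
datum is `stepScale·𝒬ᵀ` of the multiplier column), leaf-06 g46 `RelInvWardPairing.tsum_mul_contourSumAdj_bdd` (adjointness of `𝒬ᵀ`), (α) `BlockWeightContourCommutation` (block label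
through the contour sum on the NEXT lattice), (δ2a) `PeriodicDataFaceSums` (face sums of `EI`∕`BO` of `H_j n` vanish for periodic `n`); 0 `def`, 0 cited fact, 0 `def … : Prop`, 0 sorry).
HONEST FRAMING (cell contract, verbatim): «discharging `BetaPertH` makes Bałaban's UV stability UNCONDITIONAL — a real constructive-QFT result; it is NOT the continuum limit and NOT
the Clay problem.»  HONEST DEPENDENCY (verbatim): «continuum YM on T⁴ ⇐ BetaPertH ∧ nine spine estimates (0/9 proved); BetaPertH ⇐ (D1) ∧ (D4) ∧ CAP+tail; G-an2-4 gates asym,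
D1 and NE2/3/4.»

WHY (R1 [GAN24LEAF06-G49-R1], memo `HOME/b2b-balaban-gan24-formalise-leaf-06/g49/E30-E31-CENSUS.md`).  At Bałaban's pins the closed form of the (γ) source pairing one level up,
`X_{j+1}(n⋆, 1_{B(y)}; e)` (road-P2 g44's `hX`), holds iff ONE defect vanishes: `(C2′) := ⟨C_j h, dψ⊙(BO − EI)(H_j n)⟩` with `h = colH G_{j+1}(e)` two-level, `n` block-periodic,
`ψ = 1_{B(y)}` — the (C1′) terms of the Wilson and border sectors cancel identically ((β) `GaugeLegDefectsBlockConstant` + FILE A).  THIS FILE PROVES `(C2′) = 0`: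
(E3) turns `C_j h` into `(stepScale/wVH)·𝒬ᵀ_{Lc} β`, `β := colM G_{j+1} Lc ν y′`; adjointness moves `𝒬_{Lc}` onto `dψ⊙U`, `U := (BO − EI)(H_j n)`; the label `ψ = 1_y ∘ blk` is
BLOCK-CONSTANT on the lattice of `w`, so (α) gives `𝒬_{Lc}(dψ⊙U)(μ,Y) = (1_y(Y+e_μ) − 1_y(Y))·CR(U)(μ,Y)` with the CROSSING-position sum `CR(U)(μ,Y) = Σ_{b∈box} U(μ, Lc•Y + b|_{b_μ := Lc−1})`,
a sum of `Lc` face sums of `U` over the exit face of block `Y` — each of which vanishes by (δ2a) for periodic `n`.  (ENGINE E30: (C2′) = 1.3e-11 in D = 3, 5e-12 in D = 2 for periodic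
`n` with two-level `h`; ≠ 0 for generic `n`.)
* §1 `abs_tsum_colH_source_le` (uniform bound `Σ'_t |colH G_j Lc l t κ u| ≤ C_G·Zl(δ_G)` of the source series of a response column — `Summable.tsum_le_tsum_of_inj` along
  `t ↦ Lc•t`), `sum_box_update_eq_sum_faceSum` (`Σ_{b∈box} F(update b μ (Lc−1))` is `Lc` copies of the exit-face sum — the bijections `b ↦ update b μ (Lc−1)` on the fibres
  `{b_μ = c}`), `crossingPoint_eq` (the crossing bond of the contour from `Lc•Y + b` is based at `Lc•Y + update b μ (Lc−1)`).
* §2 `contourSum_sub_EI_sub_BO` (a contour sum minus its EI and BO positions is the CROSSING-position sum) and **`twoLevel_defect_eq_zero`** — the statement in the title, with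
  `H_j n`, `EI`, `BO`, `C_j h` and `dψ` written INLINE in the letters of (α) ∕ (T1) ∕ (δ2a) (the bound on `dψ⊙(BO − EI)(H_j n)` for the adjointness step is built inside the proof).
* §3 `constraintHessianSector_twoLevel_eq_zero` — the same read through (β) `GaugeLegDefectsBlockConstant.constraintHessian_gaugeLeg_blockConstant`: an1's constraint-Hessian
  table `hessFFAt` against the block-constant pure gauge `d(1_{B(y)}∘blk)` and the comb-free leg `H_j n`, paired with `C_j h` over the constraint slots, vanishes.
Asserts NO value of any resolvent column beyond FILE F + (γ) + (T1); the Wilson-sector decomposition of `X_{j+1}`, the e3OfK unfolding and the pin assembly (⇒ `hX`) are NOT here;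
NOTHING of (W-γ) at levels ≥ 1 ∕ (INV) ∕ (S) discharged; NEVER «G-an2-4 closed» as (CONV-C); NOT D1, NOT `BetaPertH`, NOT continuum, NOT Clay.  2026-08-23; no existing file touched.
-/

noncomputable section

open Finset
open scoped BigOperators
open Literature.MathematicalPhysics.QuantumFieldTheory
open Literature.MathematicalPhysics.QuantumFieldTheory.Balaban1983to89
open Literature.MathematicalPhysics.QuantumFieldTheory.Balaban1983to89.Beta
open B12Sec2to5 (l1 l1_nonneg)
open ExpKernelCalculus (Site MKer Decays Zl summable_exp_shift' tsum_exp_shift')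
open AffineAveraging (Form1 box toSite unitVec unitVec_apply dz contourSum)
open AffineReproduction (contourSumAdj)
open AveragingContours (blk blk_block)
open AveragingContoursRooted (ctrOff ctrOff_mem_box)
open LatticeForm (quo)
open KernelSpecInstance (wΦ)
open OneStepKernelFamily (KInvStep colH)
open SecondOrderResponse (colM)
open BalabanStepJetsSucc (wVH)
open AveragingHessianKernelsRooted (hessFFAt)
open Summit.QuantumFields.BalabanUV.Beta.AxialDressingRooted (IsCombBondAt coDressKBmAt decays_coDressKBmAt_KInvStep one_le_of_neZero spr_coDressKBmAt)
open Summit.QuantumFields.BalabanUV.Beta.BorderedHessian (stepScale stepScale_ne_zero spr_KInvStep)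
open Summit.QuantumFields.BalabanUV.Beta.GAN24.RelInvWardPairing (tsum_mul_contourSumAdj_bdd summable_abs_comp_quo)
open Summit.QuantumFields.BalabanUV.Beta.GAN24.DataColumnCombRows (E2row_colH_eq_contourSumAdj_colM_succ)
open Summit.QuantumFields.BalabanUV.Beta.GAN24.BlockWeightContourCommutation (contourSum_endWeight_mul contourSum_baseWeight_mul)
open Summit.QuantumFields.BalabanUV.Beta.GAN24.GaugeLegDefectsBlockConstant (constraintHessian_gaugeLeg_blockConstant)
open Summit.QuantumFields.BalabanUV.Beta.GAN24.BorderGaugeLegBlockPotential (colH_coDressKBmAt_eq_zero_of_isCombBond)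
open Summit.QuantumFields.BalabanUV.Beta.GAN24.PeriodicDataFaceSums (summable_abs_source_colH periodic_faceSum_EI_eq_zero periodic_faceSum_BO_eq_zero)

namespace Summit.QuantumFields.BalabanUV.Beta.GAN24.TwoLevelDefectVanishing

variable {d : ℕ} {Lc : ℕ} [NeZero Lc]

/-! ## §1 Uniform bounds and the crossing-position sum -/

/-- [folklore] **UNIFORM BOUND OF THE SOURCE SERIES OF A RESPONSE COLUMN**: `Σ'_t |colH G_j Lc l t κ u| ≤ C·Zl(δ)` uniformly in the field leg (decay + the coarse points are among all points). -/
theorem abs_tsum_colH_source_le (j : ℕ) :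
    ∃ CH : ℝ, 0 ≤ CH ∧ ∀ (l κ : Fin (d + 1)) (u : Site (d + 1)),
      ∑' t : Site (d + 1), |colH (coDressKBmAt (toSite (ctrOff (d + 1) Lc)) Lc (KInvStep (d := d) Lc j)) Lc l t κ u| ≤ CH := by
  have hLc1 : 1 ≤ Lc := one_le_of_neZero Lc
  obtain ⟨δG, CG, hδG, hCG, hG⟩ := decays_coDressKBmAt_KInvStep (d := d) (ctrOff_mem_box (d := d + 1) hLc1) j
  refine ⟨CG * Zl (d + 1) δG, by have := ExpKernelCalculus.Zl_nonneg (D := d + 1) hδG; positivity, fun l κ u => ?_⟩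
  have hL : (Lc : ℤ) ≠ 0 := by exact_mod_cast NeZero.ne Lc
  have hinj : Function.Injective fun t : Site (d + 1) => (Lc : ℤ) • t := fun t t' h => by
    funext i; have := congrFun h i; simp only [Pi.smul_apply, smul_eq_mul] at this; exact mul_left_cancel₀ hL this
  have hg : Summable fun x : Site (d + 1) => CG * Real.exp (-δG * l1 (u - x)) := by
    have := (summable_exp_shift' hδG u).mul_left CG
    refine this.congr fun x => ?_
    rw [ExpKernelCalculus.l1_sub_symm]
  have hle := Summable.tsum_le_tsum_of_inj (f := fun t : Site (d + 1) => |colH (coDressKBmAt (toSite (ctrOff (d + 1) Lc)) Lc (KInvStep (d := d) Lc j)) Lc l t κ u|)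
    (g := fun x : Site (d + 1) => CG * Real.exp (-δG * l1 (u - x))) (fun t : Site (d + 1) => (Lc : ℤ) • t) hinj
    (fun x _ => by positivity) (fun t => hG u ((Lc : ℤ) • t) (Sum.inl κ) (Sum.inr l)) (summable_abs_source_colH (Lc := Lc) j l κ u) hg
  refine hle.trans (le_of_eq ?_)
  rw [tsum_mul_left]
  congr 1
  have := tsum_exp_shift' (D := d + 1) (c := δG) u
  rw [← this]
  exact tsum_congr fun x => by rw [ExpKernelCalculus.l1_sub_symm]

omit [NeZero Lc] in
/-- [folklore] **THE CROSSING-POSITION SUM IS A SUM OF FACE SUMS**: for any `F : (Fin (d+1) → ℕ) → ℝ`,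
`Σ_{b∈box} F(update b μ (Lc−1)) = Σ_{c<Lc} Σ_{r∈box, r_μ = Lc−1} F r` (on each fibre `{b_μ = c}` the map `b ↦ update b μ (Lc−1)` is a bijection onto the face `{r_μ = Lc−1}`). -/
theorem sum_box_update_eq_sum_faceSum (μ : Fin (d + 1)) (F : (Fin (d + 1) → ℕ) → ℝ) :
    ∑ b ∈ box (d + 1) Lc, F (Function.update b μ (Lc - 1))
      = ∑ _c ∈ Finset.range Lc, ∑ r ∈ (box (d + 1) Lc).filter (fun r => r μ = Lc - 1), F r := by
  classical
  have hmem : ∀ {b : Fin (d + 1) → ℕ}, b ∈ box (d + 1) Lc ↔ ∀ i, b i < Lc := fun {b} => by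
    simp [AffineAveraging.box, Fintype.mem_piFinset, Finset.mem_range]
  rw [← Finset.sum_fiberwise_of_maps_to (s := box (d + 1) Lc) (t := Finset.range Lc) (g := fun b => b μ)
    (fun b hb => Finset.mem_range.2 (hmem.1 hb μ))]
  refine Finset.sum_congr rfl fun c hc => ?_
  have hcL : c < Lc := Finset.mem_range.1 hc
  -- bijection `b ↦ update b μ (Lc-1)` from `{b ∈ box, b μ = c}` onto `{r ∈ box, r μ = Lc-1}`, inverse `r ↦ update r μ c`
  refine Finset.sum_nbij' (fun b => Function.update b μ (Lc - 1)) (fun r => Function.update r μ c) ?_ ?_ ?_ ?_ ?_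
  · intro b hb
    obtain ⟨hb1, hb2⟩ := Finset.mem_filter.1 hb
    refine Finset.mem_filter.2 ⟨hmem.2 fun i => ?_, by simp⟩
    by_cases hi : i = μ
    · subst hi; simp; omega
    · rw [Function.update_of_ne hi]; exact hmem.1 hb1 i
  · intro r hr
    obtain ⟨hr1, hr2⟩ := Finset.mem_filter.1 hr
    refine Finset.mem_filter.2 ⟨hmem.2 fun i => ?_, by simp⟩
    by_cases hi : i = μ
    · subst hi; simp; exact hcL
    · rw [Function.update_of_ne hi]; exact hmem.1 hr1 i
  · intro b hb
    obtain ⟨-, hb2⟩ := Finset.mem_filter.1 hb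
    funext i
    by_cases hi : i = μ
    · subst hi; simp [hb2]
    · simp [Function.update_of_ne hi]
  · intro r hr
    obtain ⟨-, hr2⟩ := Finset.mem_filter.1 hr
    funext i
    by_cases hi : i = μ
    · subst hi; simp [hr2]
    · simp [Function.update_of_ne hi]
  · intro b hb; rfl

omit [NeZero Lc] in
/-- [folklore] The crossing bond of the contour from `Lc•Y + b` at the position `s = Lc − 1 − b_μ` is based at `Lc•Y + update b μ (Lc−1)`. -/
theorem crossingPoint_eq {b : Fin (d + 1) → ℕ} (hb : b ∈ box (d + 1) Lc) (μ : Fin (d + 1)) (Y : Site (d + 1)) :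
    (Lc : ℤ) • Y + toSite b + (((Lc - 1 - b μ : ℕ) : ℤ)) • unitVec μ = (Lc : ℤ) • Y + toSite (Function.update b μ (Lc - 1)) := by
  have hbμ : b μ < Lc := Finset.mem_range.1 (Fintype.mem_piFinset.1 hb μ)
  funext i
  simp only [Pi.add_apply, Pi.smul_apply, smul_eq_mul, AffineAveraging.toSite, unitVec_apply]
  by_cases hi : i = μ
  · subst hi; simp; push_cast [Nat.sub_sub, show 1 + b i ≤ Lc by omega, show 1 ≤ Lc by omega]; ring
  · rw [if_neg hi, Function.update_of_ne hi]; ring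

/-! ## §2 The two-level defect vanishes -/

omit [NeZero Lc] in
/-- NOT IN PRINT; OUR BOOKKEEPING.  **THE CROSSING-POSITION SUM OF THE NEXT CONTOUR**: for every real `U` on the bonds of the `w`-lattice,
`𝒬_{Lc} U μ Y − EI_{Lc} U μ Y − BO_{Lc} U μ Y = Σ_{b∈box} U μ (Lc•Y + update b μ (Lc−1))` (the positions `b_μ + s = Lc − 1`, one per box point). -/
theorem contourSum_sub_EI_sub_BO (U : Form1 (d + 1) ℝ) (μ : Fin (d + 1)) (Y : Site (d + 1)) :
    contourSum Lc U μ Y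
      - (∑ b ∈ box (d + 1) Lc, ∑ s ∈ Finset.range Lc, (if b μ + s + 1 < Lc then U μ ((Lc : ℤ) • Y + toSite b + (s : ℤ) • unitVec μ) else 0))
      - (∑ b ∈ box (d + 1) Lc, ∑ s ∈ Finset.range Lc, (if Lc ≤ b μ + s then U μ ((Lc : ℤ) • Y + toSite b + (s : ℤ) • unitVec μ) else 0))
      = ∑ b ∈ box (d + 1) Lc, U μ ((Lc : ℤ) • Y + toSite (Function.update b μ (Lc - 1))) := by
  classical
  simp only [AffineAveraging.contourSum, ← Finset.sum_sub_distrib]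
  refine Finset.sum_congr rfl fun b hb => ?_
  have hbμ : b μ < Lc := Finset.mem_range.1 (Fintype.mem_piFinset.1 hb μ)
  -- per box point: the `s`-sum leaves exactly the crossing position `s₀ = Lc − 1 − b_μ`
  have e : ∀ s ∈ Finset.range Lc, U μ ((Lc : ℤ) • Y + toSite b + (s : ℤ) • unitVec μ)
        - (if b μ + s + 1 < Lc then U μ ((Lc : ℤ) • Y + toSite b + (s : ℤ) • unitVec μ) else 0)
        - (if Lc ≤ b μ + s then U μ ((Lc : ℤ) • Y + toSite b + (s : ℤ) • unitVec μ) else 0)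
      = if s = Lc - 1 - b μ then U μ ((Lc : ℤ) • Y + toSite b + (s : ℤ) • unitVec μ) else 0 := by
    intro s hs
    by_cases h1 : b μ + s + 1 < Lc
    · rw [if_pos h1, if_neg (by omega), if_neg (by omega)]; ring
    · by_cases h2 : Lc ≤ b μ + s
      · rw [if_neg h1, if_pos h2, if_neg (by omega)]; ring
      · rw [if_neg h1, if_neg h2, if_pos (by omega)]; ring
  rw [Finset.sum_congr rfl e, Finset.sum_ite_eq' (Finset.range Lc) (Lc - 1 - b μ), if_pos (Finset.mem_range.2 (by omega))]
  rw [show (((Lc - 1 - b μ : ℕ) : ℤ)) = ((Lc - 1 - b μ : ℕ) : ℤ) from rfl, crossingPoint_eq hb μ Y]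

/-- NOT IN PRINT; OUR BOOKKEEPING.  **THE TWO-LEVEL DEFECT (C2′) VANISHES** (`Lc` odd, centred root `ρ = toSite (ctrOff (d+1) Lc)`, every level `j`, every slot `(ν, y′)` of `G_{j+1}`, every
BOUNDED `Lc`-PERIODIC datum `n` on the lattice of `G_{j+1}`, every block label `y`):
`Σ'_w Σ_μ dψ(μ,w)·U(μ,w)·C(μ,w) = 0`, where (all INLINE) `ψ = 1_{B(y)}` (`dψ(μ,w) = [blk(w+e_μ) = y] − [blk w = y]`), `U = (BO_{Lc} − EI_{Lc})(H_j n)` (FILE (α)'s letters),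
`H_j n μ u = Σ_l Σ'_t n l t·colH G_j Lc l t μ u`, `C(μ,w) = Σ'_v Σ_l wΦ_{Lc^{j+1}} μ l (w − v)·colH G_{j+1} Lc ν y′ l v` (the value-Hessian image of the two-level datum = `C_j h`). -/
theorem twoLevel_defect_eq_zero (hLc : Odd Lc) (j : ℕ) (ν : Fin (d + 1)) (y' : Site (d + 1)) {n : Form1 (d + 1) ℝ} {Bn : ℝ} (hnB : ∀ l t, |n l t| ≤ Bn)
    (hper : ∀ (l : Fin (d + 1)) (t z : Site (d + 1)), n l (t + (Lc : ℤ) • z) = n l t) (y : Site (d + 1)) :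
    ∑' w : Site (d + 1), ∑ μ,
      (((if blk Lc (w + unitVec μ) = y then (1 : ℝ) else 0) - (if blk Lc w = y then (1 : ℝ) else 0))
        * ((∑ b ∈ box (d + 1) Lc, ∑ s ∈ Finset.range Lc, (if Lc ≤ b μ + s then
              (∑ l, ∑' t : Site (d + 1), n l t * colH (coDressKBmAt (toSite (ctrOff (d + 1) Lc)) Lc (KInvStep (d := d) Lc j)) Lc l t μ
                ((Lc : ℤ) • w + toSite b + (s : ℤ) • unitVec μ)) else 0))
          - (∑ b ∈ box (d + 1) Lc, ∑ s ∈ Finset.range Lc, (if b μ + s + 1 < Lc then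
              (∑ l, ∑' t : Site (d + 1), n l t * colH (coDressKBmAt (toSite (ctrOff (d + 1) Lc)) Lc (KInvStep (d := d) Lc j)) Lc l t μ
                ((Lc : ℤ) • w + toSite b + (s : ℤ) • unitVec μ)) else 0)))
        * (∑' v : Site (d + 1), ∑ l : Fin (d + 1), wΦ (N := Lc ^ (j + 1)) μ l (w - v)
            * colH (coDressKBmAt (toSite (ctrOff (d + 1) Lc)) Lc (KInvStep (d := d) Lc (j + 1))) Lc ν y' l v)) = 0 := by
  classical
  have hLc1 : 1 ≤ Lc := one_le_of_neZero Lc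
  have hr := ctrOff_mem_box (d := d + 1) hLc1
  set G := coDressKBmAt (toSite (ctrOff (d + 1) Lc)) Lc (KInvStep (d := d) Lc j) with hGdef
  set G1 := coDressKBmAt (toSite (ctrOff (d + 1) Lc)) Lc (KInvStep (d := d) Lc (j + 1)) with hG1def
  -- the inline objects as functions
  set Hn : Form1 (d + 1) ℝ := fun μ u => ∑ l, ∑' t : Site (d + 1), n l t * colH G Lc l t μ u with hHn
  set U : Form1 (d + 1) ℝ := fun μ w =>
    (∑ b ∈ box (d + 1) Lc, ∑ s ∈ Finset.range Lc, (if Lc ≤ b μ + s then Hn μ ((Lc : ℤ) • w + toSite b + (s : ℤ) • unitVec μ) else 0))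
      - (∑ b ∈ box (d + 1) Lc, ∑ s ∈ Finset.range Lc, (if b μ + s + 1 < Lc then Hn μ ((Lc : ℤ) • w + toSite b + (s : ℤ) • unitVec μ) else 0)) with hU
  set dψ : Form1 (d + 1) ℝ := fun μ w => (if blk Lc (w + unitVec μ) = y then (1 : ℝ) else 0) - (if blk Lc w = y then (1 : ℝ) else 0) with hdψ
  set C : Form1 (d + 1) ℝ := fun μ w => ∑' v : Site (d + 1), ∑ l : Fin (d + 1), wΦ (N := Lc ^ (j + 1)) μ l (w - v) * colH G1 Lc ν y' l v with hC
  set β : Form1 (d + 1) ℝ := colM G1 Lc ν y' with hβ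
  show ∑' w : Site (d + 1), ∑ μ, dψ μ w * U μ w * C μ w = 0
  -- (E3): `wVH·C = stepScale·𝒬ᵀβ`
  have hE3 : ∀ μ w, wVH d Lc (j + 1) * C μ w = stepScale d Lc (j + 1) * contourSumAdj Lc β μ w := fun μ w =>
    E2row_colH_eq_contourSumAdj_colM_succ (d := d) hr j ν y' μ w
  have hwVH : wVH d Lc (j + 1) ≠ 0 := by
    unfold BalabanStepJetsSucc.wVH; exact pow_ne_zero _ (pow_ne_zero _ (by exact_mod_cast NeZero.ne Lc))
  -- bounds: `dψ·U` is bounded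
  obtain ⟨CH, hCH0, hCH⟩ := abs_tsum_colH_source_le (d := d) (Lc := Lc) j
  have hBn : 0 ≤ Bn := (abs_nonneg _).trans (hnB 0 0)
  have hHnb : ∀ μ u, |Hn μ u| ≤ ((d : ℝ) + 1) * (Bn * CH) := by
    intro μ u
    simp only [hHn]
    refine (Finset.abs_sum_le_sum_abs _ _).trans ?_
    have hterm : ∀ l, |∑' t : Site (d + 1), n l t * colH G Lc l t μ u| ≤ Bn * CH := by
      intro l
      have hs : Summable fun t : Site (d + 1) => |n l t * colH G Lc l t μ u| := by
        refine Summable.of_nonneg_of_le (fun _ => abs_nonneg _) (fun t => ?_) ((summable_abs_source_colH (Lc := Lc) j l μ u).mul_left Bn)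
        rw [abs_mul]; exact mul_le_mul_of_nonneg_right (hnB l t) (abs_nonneg _)
      have h1 : |∑' t : Site (d + 1), n l t * colH G Lc l t μ u| ≤ ∑' t : Site (d + 1), |n l t * colH G Lc l t μ u| := by
        have := norm_tsum_le_tsum_norm (f := fun t : Site (d + 1) => n l t * colH G Lc l t μ u) (by simpa only [Real.norm_eq_abs] using hs)
        simpa only [Real.norm_eq_abs] using this
      refine h1.trans ?_
      calc ∑' t : Site (d + 1), |n l t * colH G Lc l t μ u| ≤ ∑' t : Site (d + 1), Bn * |colH G Lc l t μ u| :=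
            hs.tsum_le_tsum (fun t => by rw [abs_mul]; exact mul_le_mul_of_nonneg_right (hnB l t) (abs_nonneg _))
              ((summable_abs_source_colH (Lc := Lc) j l μ u).mul_left Bn)
        _ = Bn * ∑' t : Site (d + 1), |colH G Lc l t μ u| := tsum_mul_left
        _ ≤ Bn * CH := mul_le_mul_of_nonneg_left (hCH l μ u) hBn
    calc ∑ l, |∑' t : Site (d + 1), n l t * colH G Lc l t μ u| ≤ ∑ _l : Fin (d + 1), Bn * CH := Finset.sum_le_sum fun l _ => hterm l
      _ = ((d : ℝ) + 1) * (Bn * CH) := by rw [Finset.sum_const, Finset.card_univ, Fintype.card_fin, nsmul_eq_mul]; push_cast; ring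
  set BH : ℝ := ((d : ℝ) + 1) * (Bn * CH) with hBH
  have hBH0 : 0 ≤ BH := by rw [hBH]; positivity
  have hpart : ∀ (Q : (Fin (d + 1) → ℕ) → ℕ → Prop) [∀ b s, Decidable (Q b s)] (μ : Fin (d + 1)) (w : Site (d + 1)),
      |∑ b ∈ box (d + 1) Lc, ∑ s ∈ Finset.range Lc, (if Q b s then Hn μ ((Lc : ℤ) • w + toSite b + (s : ℤ) • unitVec μ) else 0)|
        ≤ ((box (d + 1) Lc).card : ℝ) * ((Lc : ℝ) * BH) := by
    intro Q _ μ w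
    refine (Finset.abs_sum_le_sum_abs _ _).trans ?_
    calc ∑ b ∈ box (d + 1) Lc, |∑ s ∈ Finset.range Lc, (if Q b s then Hn μ ((Lc : ℤ) • w + toSite b + (s : ℤ) • unitVec μ) else 0)|
        ≤ ∑ _b ∈ box (d + 1) Lc, (Lc : ℝ) * BH := Finset.sum_le_sum fun b _ => by
          refine (Finset.abs_sum_le_sum_abs _ _).trans ?_
          calc ∑ s ∈ Finset.range Lc, |(if Q b s then Hn μ ((Lc : ℤ) • w + toSite b + (s : ℤ) • unitVec μ) else 0)|
              ≤ ∑ _s ∈ Finset.range Lc, BH := Finset.sum_le_sum fun s _ => by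
                split_ifs
                · exact hHnb _ _
                · rw [abs_zero]; exact hBH0
            _ = (Lc : ℝ) * BH := by rw [Finset.sum_const, Finset.card_range, nsmul_eq_mul]
      _ = ((box (d + 1) Lc).card : ℝ) * ((Lc : ℝ) * BH) := by rw [Finset.sum_const, nsmul_eq_mul]
  have hUb : ∀ μ w, |U μ w| ≤ 2 * (((box (d + 1) Lc).card : ℝ) * ((Lc : ℝ) * BH)) := by
    intro μ w
    simp only [hU]
    refine (abs_sub _ _).trans ?_
    have h1 := hpart (fun b s => Lc ≤ b μ + s) μ w
    have h2 := hpart (fun b s => b μ + s + 1 < Lc) μ w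
    linarith
  have hdψb : ∀ μ w, |dψ μ w| ≤ 2 := by
    intro μ w
    simp only [hdψ]
    refine (abs_sub _ _).trans ?_
    have : ∀ (P : Prop) [Decidable P], |(if P then (1 : ℝ) else 0)| ≤ 1 := fun P _ => by split <;> simp
    linarith [this (blk Lc (w + unitVec μ) = y), this (blk Lc w = y)]
  have hm : ∀ μ w, |dψ μ w * U μ w| ≤ 2 * (2 * (((box (d + 1) Lc).card : ℝ) * ((Lc : ℝ) * BH))) := by
    intro μ w
    rw [abs_mul]
    exact mul_le_mul (hdψb μ w) (hUb μ w) (abs_nonneg _) (by norm_num)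
  -- summability of `β ∘ quo`
  obtain ⟨C1, δ1, hδ1, hG1d⟩ := spr_coDressKBmAt hLc1 hr (spr_KInvStep (d := d) (Lc := Lc) (j + 1))
  have hφ : ∀ κ, Summable fun u : Site (d + 1) => |β κ (quo Lc u)| := fun κ => by
    have := summable_abs_comp_quo (N := Lc) hLc1 hδ1 hG1d ((Lc : ℤ) • y') (Sum.inr κ) (Sum.inr ν)
    exact this.congr fun u => by simp only [hβ, hG1def, SecondOrderResponse.colM]
  -- the main chain
  have step1 : wVH d Lc (j + 1) * (∑' w : Site (d + 1), ∑ μ, dψ μ w * U μ w * C μ w)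
      = stepScale d Lc (j + 1) * ∑' w : Site (d + 1), ∑ μ, (dψ μ w * U μ w) * contourSumAdj Lc β μ w := by
    rw [← tsum_mul_left, ← tsum_mul_left]
    refine tsum_congr fun w => ?_
    rw [Finset.mul_sum, Finset.mul_sum]
    refine Finset.sum_congr rfl fun μ _ => ?_
    have := hE3 μ w
    calc wVH d Lc (j + 1) * (dψ μ w * U μ w * C μ w) = dψ μ w * U μ w * (wVH d Lc (j + 1) * C μ w) := by ring
      _ = dψ μ w * U μ w * (stepScale d Lc (j + 1) * contourSumAdj Lc β μ w) := by rw [this]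
      _ = stepScale d Lc (j + 1) * (dψ μ w * U μ w * contourSumAdj Lc β μ w) := by ring
  have step2 : (∑' w : Site (d + 1), ∑ μ, (dψ μ w * U μ w) * contourSumAdj Lc β μ w)
      = ∑' Y : Site (d + 1), ∑ μ, β μ Y * contourSum Lc (fun μ w => dψ μ w * U μ w) μ Y :=
    tsum_mul_contourSumAdj_bdd (N := Lc) (m := fun μ w => dψ μ w * U μ w) hm hφ
  -- per coarse bond: the contour sum of `dψ⊙U` is the crossing-position sum, a sum of vanishing face sums
  have step3 : ∀ μ Y, contourSum Lc (fun μ w => dψ μ w * U μ w) μ Y = 0 := by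
    intro μ Y
    set ψb : Site (d + 1) → ℝ := fun Z => if Z = y then 1 else 0 with hψb
    have esplit : (fun μ (w : Site (d + 1)) => dψ μ w * U μ w)
        = (fun μ w => ψb (blk Lc (w + unitVec μ)) * U μ w) - (fun μ w => ψb (blk Lc w) * U μ w) := by
      funext μ w; simp only [hdψ, hψb, Pi.sub_apply]; ring
    have hsub : ∀ (A B : Form1 (d + 1) ℝ), contourSum Lc (A - B) μ Y = contourSum Lc A μ Y - contourSum Lc B μ Y := fun A B => by
      simp only [AffineAveraging.contourSum, Pi.sub_apply, Finset.sum_sub_distrib]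
    rw [esplit, hsub, contourSum_endWeight_mul hLc1 ψb U μ Y, contourSum_baseWeight_mul hLc1 ψb U μ Y]
    have ecr := contourSum_sub_EI_sub_BO (d := d) (Lc := Lc) U μ Y
    have eface : ∑ b ∈ box (d + 1) Lc, U μ ((Lc : ℤ) • Y + toSite (Function.update b μ (Lc - 1))) = 0 := by
      rw [sum_box_update_eq_sum_faceSum μ (fun r => U μ ((Lc : ℤ) • Y + toSite r))]
      refine Finset.sum_eq_zero fun c _ => ?_
      have hBO := periodic_faceSum_BO_eq_zero (d := d) hLc j hnB hper μ Y (Lc - 1)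
      have hEI := periodic_faceSum_EI_eq_zero (d := d) hLc j hnB hper μ Y (Lc - 1)
      simp only [hU, hHn, Finset.sum_sub_distrib]
      rw [hBO, hEI, sub_self]
    have key : contourSum Lc U μ Y
        - (∑ b ∈ box (d + 1) Lc, ∑ s ∈ Finset.range Lc, (if b μ + s + 1 < Lc then U μ ((Lc : ℤ) • Y + toSite b + (s : ℤ) • unitVec μ) else 0))
        - (∑ b ∈ box (d + 1) Lc, ∑ s ∈ Finset.range Lc, (if Lc ≤ b μ + s then U μ ((Lc : ℤ) • Y + toSite b + (s : ℤ) • unitVec μ) else 0)) = 0 := by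
      rw [ecr, eface]
    simp only [AffineAveraging.dz]
    linear_combination (ψb (Y + unitVec μ) - ψb Y) * key
  have step4 : (∑' Y : Site (d + 1), ∑ μ, β μ Y * contourSum Lc (fun μ w => dψ μ w * U μ w) μ Y) = 0 := by
    simp [step3]
  have hfin : wVH d Lc (j + 1) * (∑' w : Site (d + 1), ∑ μ, dψ μ w * U μ w * C μ w) = 0 := by
    rw [step1, step2, step4, mul_zero]
  exact (mul_eq_zero.1 hfin).resolve_left hwVH

/-! ## §3 The constraint-Hessian sector against the two-level datum -/

/-- NOT IN PRINT; OUR BOOKKEEPING.  **THE CONSTRAINT-HESSIAN SECTOR OF THE TWO-LEVEL PAIRING VANISHES FOR PERIODIC DATA** (same hypotheses as §2): by (β)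
`GaugeLegDefectsBlockConstant.constraintHessian_gaugeLeg_blockConstant` the `hessFFAt` table against the block-constant pure gauge `d(1_{B(y)} ∘ blk)` and the comb-free
leg `H_j n` (comb-free by `BorderGaugeLegBlockPotential.colH_coDressKBmAt_eq_zero_of_isCombBond`) is `−(2Lc^{d+1})⁻¹·dψ·(BO_{Lc} − EI_{Lc})(H_j n)` slot by slot, so its pairing
with `C_j h` over the constraint slots `(μ, w)` is `−(2Lc^{d+1})⁻¹·(C2′) = 0` (§2):
`Σ'_w Σ_μ (C_j h)(μ,w)·Σ'_u Σ_κ (H_j n) κ u·(Σ'_x Σ_κ₂ hessFFAt ρ Lc μ w u x (inl κ)(inl κ₂)·dz (1_{B(y)} ∘ blk) κ₂ x) = 0`. -/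
theorem constraintHessianSector_twoLevel_eq_zero (hLc : Odd Lc) (j : ℕ) (ν : Fin (d + 1)) (y' : Site (d + 1)) {n : Form1 (d + 1) ℝ} {Bn : ℝ}
    (hnB : ∀ l t, |n l t| ≤ Bn) (hper : ∀ (l : Fin (d + 1)) (t z : Site (d + 1)), n l (t + (Lc : ℤ) • z) = n l t) (y : Site (d + 1)) :
    ∑' w : Site (d + 1), ∑ μ,
      (∑' v : Site (d + 1), ∑ l : Fin (d + 1), wΦ (N := Lc ^ (j + 1)) μ l (w - v)
          * colH (coDressKBmAt (toSite (ctrOff (d + 1) Lc)) Lc (KInvStep (d := d) Lc (j + 1))) Lc ν y' l v)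
        * (∑' u : Site (d + 1), ∑ κ,
            (∑ l, ∑' t : Site (d + 1), n l t * colH (coDressKBmAt (toSite (ctrOff (d + 1) Lc)) Lc (KInvStep (d := d) Lc j)) Lc l t κ u)
              * (∑' x : Site (d + 1), ∑ κ₂, hessFFAt (toSite (ctrOff (d + 1) Lc)) Lc μ w u x (Sum.inl κ) (Sum.inl κ₂)
                  * dz (fun z => if blk Lc (blk Lc z) = y then (1 : ℝ) else 0) κ₂ x)) = 0 := by
  classical
  have hLc1 : 1 ≤ Lc := one_le_of_neZero Lc
  have hr := ctrOff_mem_box (d := d + 1) hLc1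
  have hmain := twoLevel_defect_eq_zero (d := d) hLc j ν y' hnB hper y
  set G := coDressKBmAt (toSite (ctrOff (d + 1) Lc)) Lc (KInvStep (d := d) Lc j) with hGdef
  set G1 := coDressKBmAt (toSite (ctrOff (d + 1) Lc)) Lc (KInvStep (d := d) Lc (j + 1)) with hG1def
  set Hn : Form1 (d + 1) ℝ := fun κ u => ∑ l, ∑' t : Site (d + 1), n l t * colH G Lc l t κ u with hHn
  set U : Form1 (d + 1) ℝ := fun μ w =>
    (∑ b ∈ box (d + 1) Lc, ∑ s ∈ Finset.range Lc, (if Lc ≤ b μ + s then Hn μ ((Lc : ℤ) • w + toSite b + (s : ℤ) • unitVec μ) else 0))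
      - (∑ b ∈ box (d + 1) Lc, ∑ s ∈ Finset.range Lc, (if b μ + s + 1 < Lc then Hn μ ((Lc : ℤ) • w + toSite b + (s : ℤ) • unitVec μ) else 0)) with hU
  set dψ : Form1 (d + 1) ℝ := fun μ w => (if blk Lc (w + unitVec μ) = y then (1 : ℝ) else 0) - (if blk Lc w = y then (1 : ℝ) else 0) with hdψ
  set C : Form1 (d + 1) ℝ := fun μ w => ∑' v : Site (d + 1), ∑ l : Fin (d + 1), wΦ (N := Lc ^ (j + 1)) μ l (w - v) * colH G1 Lc ν y' l v with hC
  replace hmain : ∑' w : Site (d + 1), ∑ μ, dψ μ w * U μ w * C μ w = 0 := hmain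
  show ∑' w : Site (d + 1), ∑ μ, C μ w * (∑' u : Site (d + 1), ∑ κ, Hn κ u
      * (∑' x : Site (d + 1), ∑ κ₂, hessFFAt (toSite (ctrOff (d + 1) Lc)) Lc μ w u x (Sum.inl κ) (Sum.inl κ₂)
          * dz (fun z => if blk Lc (blk Lc z) = y then (1 : ℝ) else 0) κ₂ x)) = 0
  -- `H_j n` is comb-free
  have ha : ∀ κ u, IsCombBondAt (toSite (ctrOff (d + 1) Lc)) Lc κ u → Hn κ u = 0 := by
    intro κ u hc
    simp only [hHn]
    refine Finset.sum_eq_zero fun l _ => ?_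
    have h0 : ∀ t : Site (d + 1), n l t * colH G Lc l t κ u = 0 := fun t => by
      rw [hGdef, colH_coDressKBmAt_eq_zero_of_isCombBond (toSite (ctrOff (d + 1) Lc)) (KInvStep (d := d) Lc j) l t hc, mul_zero]
    simp only [h0, tsum_zero]
  -- (β): the constraint-Hessian table slot by slot
  have hβ' : ∀ μ w, (∑' u : Site (d + 1), ∑ κ, Hn κ u
        * (∑' x : Site (d + 1), ∑ κ₂, hessFFAt (toSite (ctrOff (d + 1) Lc)) Lc μ w u x (Sum.inl κ) (Sum.inl κ₂)
            * dz (fun z => if blk Lc (blk Lc z) = y then (1 : ℝ) else 0) κ₂ x))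
      = -((2 * (Lc : ℝ) ^ (d + 1))⁻¹ * (dψ μ w * U μ w)) := fun μ w => by
    have := constraintHessian_gaugeLeg_blockConstant (d := d) hLc1 hr μ w ha (fun w => if blk Lc w = y then (1 : ℝ) else 0)
    simpa only [AffineAveraging.dz, hdψ, hU] using this
  have e1 : (∑' w : Site (d + 1), ∑ μ, C μ w * (∑' u : Site (d + 1), ∑ κ, Hn κ u
        * (∑' x : Site (d + 1), ∑ κ₂, hessFFAt (toSite (ctrOff (d + 1) Lc)) Lc μ w u x (Sum.inl κ) (Sum.inl κ₂)
            * dz (fun z => if blk Lc (blk Lc z) = y then (1 : ℝ) else 0) κ₂ x)))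
      = -((2 * (Lc : ℝ) ^ (d + 1))⁻¹) * ∑' w : Site (d + 1), ∑ μ, dψ μ w * U μ w * C μ w := by
    rw [← tsum_mul_left]
    refine tsum_congr fun w => ?_
    rw [Finset.mul_sum]
    refine Finset.sum_congr rfl fun μ _ => ?_
    rw [hβ' μ w]; ring
  rw [e1, hmain, mul_zero]

end Summit.QuantumFields.BalabanUV.Beta.GAN24.TwoLevelDefectVanishing

end
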